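import Mathlib
import HarnessLib
import Summits.HubbardSuperconductivity.HubbardSuperconductivity.Theorems.KLProgrammeKLRegimeVolumeLimitV11HSupOfAtomsBWFree
import Summits.HubbardSuperconductivity.HubbardSuperconductivity.Theorems.KLProgrammeKLRegimeTwoVolumeTowerDataTSWExistsH0W

/-!
# Route `KLProgramme` — crux K3, VL child `KLRegimeVolumeLimitV17F3` (stmt-HubbardSuperconductivity-23356), cure of LR13′ «(VL)-HUV-CURRENCY-PROPAGATION»,
# consumer step C2c: THE BODY OF `hSup` WITH TOKEN #24 IN THE WINDOWED CURRENCY (twin of `…V11HSupOfAtomsBWFree.hSupRegBody_of_atomsBW_free`;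
# seat hubbard-kl-k3c4-p1 g20; `--supports` 23356)

Byte-identical to `hSupRegBody_of_atomsBW_free` (k3c4-p1 g18) except that the producer text `htok` reads token #24 in the WINDOWED currency
`SourceProfilesAtLevF L M (klSrcBudget P Q′ U A (j+1)) β U μ K_top (srcWindowFamily L M) j j (j+1)` (`…TwoVolumeSourceProfileDefsF`) and the package is built by
`…TowerDataTSWExistsH0W.exists_towerDataTSW_of_readoutsH0W` (no `ℓ¹` rows of the smoothing kernel).

* **`hSupRegBody_of_atomsBW_freeW`**.

Proofs only; no definition.  Honest framing: quantifier threading over landed theorems; nothing asserts the atoms, K3, VL or superconductivity.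
[cite: BenfattoGiulianiMastropietro2006, §2.7-§2.9 and §3]
-/

noncomputable section

open Finset Filter Topology Literature.MathematicalPhysics.QuantumLattice Literature.Probability.LatticeModels GrassmannAlgebra
open Summit.HubbardSuperconductivity.HubbardSuperconductivity.Theorems.EngineV8
open Summit.HubbardSuperconductivity.HubbardSuperconductivity.Theorems.KLProgrammeLegKernels
open Summit.HubbardSuperconductivity.HubbardSuperconductivity.Theorems.KLRegimeSplit
open Summit.HubbardSuperconductivity.HubbardSuperconductivity.Theorems.TwoPointAssembly
open Summit.HubbardSuperconductivity.HubbardSuperconductivity.Theorems.TwoVolumeDefect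
open Summit.HubbardSuperconductivity.HubbardSuperconductivity.Theorems.TwoVolumeSource
open Summit.HubbardSuperconductivity.HubbardSuperconductivity.Theorems.TorusFourierL2

set_option linter.dupNamespace false -- summit = problem name (single-conjunct summit), D-0017

namespace Summit.HubbardSuperconductivity.HubbardSuperconductivity.Theorems.TwoVolumeSource

/-- **THE BODY OF `hSup` (thresholded form) AT `(G, P, Q, R, Q′)`, `R.WF2`, FROM `Hcov`, THE HISTORY-FREE `HE1free`, `Hmis`, `HB1W`** (see the module docstring).
[folklore: quantifier threading; cite: BenfattoGiulianiMastropietro2006, §2.7-§2.9 and §3] -/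
theorem hSupRegBody_of_atomsBW_freeW
    (Hcov : ∀ (G : GeoConsts) (P : SplitConsts) (Q : EngConsts) (R : RenConsts), G.WF → P.WF → Q.WF → R.WF2 →
      ∃ k₁ a₁ s₁ e₁ w₁ ρ : ℝ, 0 < k₁ ∧ 0 < a₁ ∧ 0 ≤ s₁ ∧ 0 ≤ e₁ ∧ 1 ≤ w₁ ∧ 0 < ρ ∧
        ∃ c₇ : ℝ, 0 < c₇ ∧ ∀ c : ℝ, 0 < c → c ≤ c₇ → ∃ U₇ : ℝ, 0 < U₇ ∧
          ∀ μ ∈ klWindowC, ∀ U : ℝ, 0 < U → U ≤ U₇ → ∀ β : ℝ, klBetaMin ≤ β → β ≤ Real.exp (c / U ^ 2) →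
            ∀ (K : TrigPolyC4v) (Lstar : ℕ) (Mstar : ℕ → ℕ), TowerP klPredsV17F2 G P Q R β U μ K Lstar Mstar →
            ∀ Λ : ℝ, 0 ≤ Λ → Λ ≤ klScale klE0 (nScales β + 1) → Λ * (4 : ℝ) ^ (nScales β + 1) ≤ ρ →
            ∃ L₂ : ℕ, ∃ M₂ : ℕ → ℕ → ℕ, ∀ (L b M : ℕ) [NeZero L] [NeZero (b * L)] [NeZero M], L₂ ≤ L → M₂ L b ≤ M →
              (∀ j, j < nScales β → ScaleCovData (klStepCov L M β μ (klFlowFrameU L M β U μ (nScales β + 1)) j) Λ (Real.sqrt (k₁ ^ 2 * ((8 : ℝ) ^ j)⁻¹))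
                (a₁ * (4 : ℝ) ^ j / imagTimeWeight β M) s₁) ∧
              (∀ j, j < nScales β → ScaleCovData (klStepCov (b * L) M β μ (klFlowFrameU (b * L) M β U μ (nScales β + 1)) j) Λ (Real.sqrt (k₁ ^ 2 * ((8 : ℝ) ^ j)⁻¹))
                (a₁ * (4 : ℝ) ^ j / imagTimeWeight β M) s₁) ∧
              (∀ j, j < nScales β → ScaleCovData (klStepCov (b * L) M β μ (klFlowFrameU L M β U μ (nScales β + 1)) j) Λ (Real.sqrt (k₁ ^ 2 * ((8 : ℝ) ^ j)⁻¹))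
                (a₁ * (4 : ℝ) ^ j / imagTimeWeight β M) s₁) ∧
              (∀ j, j < nScales β → ScaleCovSecData (klStepCov (b * L) M β μ (klFlowFrameU L M β U μ (nScales β + 1)) j) Λ e₁) ∧
              (∀ j, j ≤ nScales β → TransferWtData (klTowerTransfer (b * L) M β μ (klFlowFrameU L M β U μ (nScales β + 1)) j)
                (klBlockEquivD L b M j) (klBlockEquivD L b M (j - 1)) Λ w₁))
    (HE1 : ∀ (P : SplitConsts) (R : RenConsts), P.WF → R.WF2 →
      ∃ Q₁ : EngConsts, 0 ≤ Q₁.CE ∧ ∃ C₀ : ℝ, 0 ≤ C₀ ∧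
        ∃ c₇ : ℝ, 0 < c₇ ∧ ∀ c : ℝ, 0 < c → c ≤ c₇ → ∃ U₇ : ℝ, 0 < U₇ ∧
          ∀ μ ∈ klWindowC, ∀ U : ℝ, 0 < U → U ≤ U₇ → ∀ β : ℝ, klBetaMin ≤ β → β ≤ Real.exp (c / U ^ 2) →
            ∃ S₀ : ℕ → ℕ → ℝ, (∀ j m, 0 ≤ S₀ j m) ∧ (∀ j, j ≤ nScales β → ∀ m, 1 ≤ m → S₀ j (2 * m) ≤ C₀ * klWtBudget P Q₁ U (j + 1) (2 * m)) ∧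
            ∃ L₂ : ℕ, ∃ M₂ : ℕ → ℕ, ∀ (L M : ℕ) [NeZero L] [NeZero M], L₂ ≤ L → M₂ L ≤ M →
              (∀ k, k ≤ nScales β → hubbardEffPartitionFnCT L M β U μ 0 (klFlowFrameU L M β U μ (nScales β + 1)) (klScale klE0 (k + 1)) ≠ 0) ∧
              (∀ j, j ≤ nScales β → ∀ (m : ℕ) (q : Fin m) (w : SpaceTimeIdx L M × SectorLeg (sectorCount j)),
                klWtPinnedSumAt L M β μ (klFlowFrameU L M β U μ (nScales β + 1)) j j m (klEffectiveAction L M β U μ (klFlowFrameU L M β U μ (nScales β + 1)) klE0 (j + 1)) q w ≤ S₀ j m))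
    (Hmis : ∀ (G : GeoConsts) (P : SplitConsts) (Q : EngConsts) (R : RenConsts), G.WF → P.WF → Q.WF → R.WF2 →
        ∃ c₇ : ℝ, 0 < c₇ ∧ ∀ c : ℝ, 0 < c → c ≤ c₇ → ∃ U₇ : ℝ, 0 < U₇ ∧
          ∀ μ ∈ klWindowC, ∀ U : ℝ, 0 < U → U ≤ U₇ → ∀ β : ℝ, klBetaMin ≤ β → β ≤ Real.exp (c / U ^ 2) →
            ∀ (K : TrigPolyC4v) (Lstar : ℕ) (Mstar : ℕ → ℕ), TowerP klPredsV17F2 G P Q R β U μ K Lstar Mstar →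
            ∃ (sE cR cC δ : ℕ → ℕ → ℝ),
              (∀ j L, 0 ≤ sE j L ∧ 0 ≤ cR j L ∧ 0 ≤ cC j L ∧ 0 ≤ δ j L ∧ cR j L ≤ 1 ∧ cC j L ≤ 1 ∧ δ j L ≤ 1) ∧
              (∀ j, Tendsto (sE j) atTop (𝓝 0) ∧ Tendsto (cR j) atTop (𝓝 0) ∧ Tendsto (cC j) atTop (𝓝 0) ∧ Tendsto (δ j) atTop (𝓝 0)) ∧
            ∃ L₂ : ℕ, ∃ M₂ : ℕ → ℕ → ℕ, ∀ (L b M : ℕ) [NeZero L] [NeZero (b * L)] [NeZero M], L₂ ≤ L → M₂ L b ≤ M →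
              (∀ j, j < nScales β → ∀ x y, ‖(klStepCov (b * L) M β μ (klFlowFrameU (b * L) M β U μ (nScales β + 1)) j - klStepCov (b * L) M β μ (klFlowFrameU L M β U μ (nScales β + 1)) j) x y‖ ≤ sE j L) ∧
              (∀ j, j < nScales β → ∀ x, ∑ y, ‖(klStepCov (b * L) M β μ (klFlowFrameU (b * L) M β U μ (nScales β + 1)) j - klStepCov (b * L) M β μ (klFlowFrameU L M β U μ (nScales β + 1)) j) x y‖ ≤
                cR j L / imagTimeWeight β M) ∧
              (∀ j, j < nScales β → ∀ y, ∑ x, ‖(klStepCov (b * L) M β μ (klFlowFrameU (b * L) M β U μ (nScales β + 1)) j - klStepCov (b * L) M β μ (klFlowFrameU L M β U μ (nScales β + 1)) j) x y‖ ≤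
                cC j L / imagTimeWeight β M) ∧
              (∀ j, j ≤ nScales β → ∀ x, ∑ y, ‖klTowerTransfer (b * L) M β μ (klFlowFrameU (b * L) M β U μ (nScales β + 1)) j x y - klTowerTransfer (b * L) M β μ (klFlowFrameU L M β U μ (nScales β + 1)) j x y‖ ≤ δ j L) ∧
              (∀ j, j ≤ nScales β → ∀ y, ∑ x, ‖klTowerTransfer (b * L) M β μ (klFlowFrameU (b * L) M β U μ (nScales β + 1)) j x y - klTowerTransfer (b * L) M β μ (klFlowFrameU L M β U μ (nScales β + 1)) j x y‖ ≤ δ j L))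
    (HB1W : ∀ (G : GeoConsts) (P : SplitConsts) (Q : EngConsts) (R : RenConsts), G.WF → P.WF → Q.WF → R.WF2 →
        ∃ c₇ : ℝ, 0 < c₇ ∧ ∀ c : ℝ, 0 < c → c ≤ c₇ → ∃ U₇ : ℝ, 0 < U₇ ∧
          ∀ μ ∈ klWindowC, ∀ U : ℝ, 0 < U → U ≤ U₇ → ∀ β : ℝ, klBetaMin ≤ β → β ≤ Real.exp (c / U ^ 2) →
            ∀ (K : TrigPolyC4v) (Lstar : ℕ) (Mstar : ℕ → ℕ), TowerP klPredsV17F2 G P Q R β U μ K Lstar Mstar →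
            ∃ M₂ : ℕ → ℕ → ℕ, ∀ (k : ℕ) (η : ℝ), 0 < η → ∃ L₂ : ℕ, ∀ (L b M : ℕ) [NeZero L] [NeZero (b * L)] [NeZero M], L₂ ≤ L → M₂ L b ≤ M →
              ∀ (p : Fin k) (w : SrcLabel (b * L) M 0),
                (∀ i, 2 * (L / (4 * nScales β + 7)) ≤ (w.1.1.2 i).val % L ∧ (w.1.1.2 i).val % L + 2 * (L / (4 * nScales β + 7)) < L) →
                klKeyedDefectTSW L b M β U μ (klFlowFrameU L M β U μ (nScales β + 1)) (klFlowFrameU (b * L) M β U μ (nScales β + 1)) 1 0 k p w ≤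
                  imagTimeWeight β M * η)
    (G : GeoConsts) (P : SplitConsts) (Q : EngConsts) (R : RenConsts) (Q' : EngConsts) (hG : G.WF) (hP : P.WF) (hQ : Q.WF) (hR2 : R.WF2)
    (hQ'CE : 0 ≤ Q'.CE) :
    ∃ (k₀ B₂ B₃ W : ℝ), 0 < k₀ ∧ 0 ≤ B₂ ∧ 0 ≤ B₃ ∧ 0 ≤ W ∧
      ∃ c₆ : ℝ, 0 < c₆ ∧ ∀ c : ℝ, 0 < c → c ≤ c₆ → ∃ U₆ : ℝ, 0 < U₆ ∧
        ∀ μ ∈ klWindowC, ∀ U : ℝ, 0 < U → U ≤ U₆ → ∀ β : ℝ, klBetaMin ≤ β → β ≤ Real.exp (c / U ^ 2) →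
          ∀ K : TrigPolyC4v, klPredsV17F2.frameOK R U (nScales β) μ K →
            ∀ (Lstar : ℕ) (Mstar : ℕ → ℕ), TowerP klPredsV17F2 G P Q R β U μ K Lstar Mstar →
              (∀ j, j ≤ nScales β → 0 < epsCoupling P U (j + 1) ∧ epsCoupling P U (j + 1) ≤ 1 ∧ B₂ * epsCoupling P U (j + 1) ≤ 1 ∧
                B₃ * epsCoupling P U (j + 1) ≤ 1 ∧ epsCoupling P U (j + 1) * W ≤ k₀ ^ 2) →
              ∀ (A : ℕ → ℕ → ℝ) (L₁ : ℕ) (M₁ : ℕ → ℕ), (∀ j s, 0 ≤ A j s) →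
                (∀ (L M : ℕ) [NeZero L] [NeZero M], L₁ ≤ L → M₁ L ≤ M → ∀ j : ℕ, j + 1 ≤ nScales β + 1 →
                  SourceProfilesAtLevF L M (klSrcBudget P Q' U A (j + 1)) β U μ (klFlowFrameU L M β U μ (nScales β + 1)) (srcWindowFamily L M) j j (j + 1)) →
                ∃ t : ℝ, 0 < t ∧ t ≤ 1 ∧ Nonempty (TowerDataTSW β U μ t) := by
  classical
  -- the atoms' volume-free constants and thresholds
  obtain ⟨k₁, a₁, s₁, e₁, w₁, ρ, hk₁, ha₁, hs₁, he₁, hw₁, hρ, c₁, hc₁, hcov⟩ := Hcov G P Q R hG hP hQ hR2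
  obtain ⟨Q₁, hQ₁CE, C₀, hC₀, c₂, hc₂, he1⟩ := HE1 P R hP hR2
  obtain ⟨c₃, hc₃, hmis⟩ := Hmis G P Q R hG hP hQ hR2
  obtain ⟨c₄, hc₄, hb1⟩ := HB1W G P Q R hG hP hQ hR2
  -- the absolute ℓ¹ constant of the smoothing (kept only as the free real of the scale-free inequalities; its rows are not needed in the windowed currency)
  obtain ⟨Cw, -, -, -⟩ := exists_srcSmoothKernel_l1_bound
  have hKl : 0 ≤ P.Klam := le_trans zero_le_one hP.1
  have hQCE : 0 ≤ Q₁.CE := hQ₁CE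
  -- the read-out's own package with `0 < CE`
  set Qp : EngConsts := { Q₁ with CE := Q₁.CE + 1 } with hQp
  have hQpCE : Qp.CE = Q₁.CE + 1 := rfl
  have hCEp : 0 < Qp.CE := by rw [hQpCE]; linarith
  -- the sizes
  set r₀ : ℝ := 8 * Real.exp 2 * ((3 : ℝ) + 1) * (w₁ + 1 + 1) with hr₀
  have hr₀0 : 0 ≤ r₀ := by positivity
  set D : ℝ := (max 1 Cw) ^ 2 * (2 * Real.exp 2 ^ 2 * (1 + r₀) ^ 2 * k₁ ^ 2) with hD
  have hD0 : 0 ≤ D := by positivity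
  refine ⟨k₁, 8 * Qp.CE * D, 8 * Q'.CE * D,
    256 * Real.exp 1 ^ 2 * (a₁ + 1 + 1 + 1) * (42 * w₁ + 4 * 1 + 8 * Real.exp 1) *
      (Qp.CE * D / 4 * (C₀ * (1 + 8 * Qp.CE * D) + 1 + 1 * Q'.CE * (1 + 8 * Q'.CE * D) / 4)),
    hk₁, by positivity, by positivity, ?_, min c₁ (min c₂ (min c₃ c₄)),
    lt_min hc₁ (lt_min hc₂ (lt_min hc₃ hc₄)), fun c hc0 hcc => ?_⟩
  · have hw0 : 0 ≤ w₁ := zero_le_one.trans hw₁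
    have : 0 ≤ Qp.CE := hCEp.le
    positivity
  have hcc₁ : c ≤ c₁ := hcc.trans (min_le_left _ _)
  have hcc₂ : c ≤ c₂ := hcc.trans ((min_le_right _ _).trans (min_le_left _ _))
  have hcc₃ : c ≤ c₃ := hcc.trans ((min_le_right _ _).trans ((min_le_right _ _).trans (min_le_left _ _)))
  have hcc₄ : c ≤ c₄ := hcc.trans ((min_le_right _ _).trans ((min_le_right _ _).trans (min_le_right _ _)))
  obtain ⟨U₁, hU₁, hcov1⟩ := hcov c hc0 hcc₁
  obtain ⟨U₂, hU₂, he11⟩ := he1 c hc0 hcc₂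
  obtain ⟨U₃, hU₃, hmis1⟩ := hmis c hc0 hcc₃
  obtain ⟨U₄, hU₄, hb11⟩ := hb1 c hc0 hcc₄
  refine ⟨min U₁ (min U₂ (min U₃ U₄)), lt_min hU₁ (lt_min hU₂ (lt_min hU₃ hU₄)), ?_⟩
  intro μ hμ U hU0 hUU β hβmin hβmax K hK Lstar Mstar hT heps A L₁ M₁ hA htok
  have hUU₁ : U ≤ U₁ := hUU.trans (min_le_left _ _)
  have hUU₂ : U ≤ U₂ := hUU.trans ((min_le_right _ _).trans (min_le_left _ _))
  have hUU₃ : U ≤ U₃ := hUU.trans ((min_le_right _ _).trans ((min_le_right _ _).trans (min_le_left _ _)))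
  have hUU₄ : U ≤ U₄ := hUU.trans ((min_le_right _ _).trans ((min_le_right _ _).trans (min_le_right _ _)))
  have hβ : 0 < β := KLRegimeSplit.pos_of_klBetaMin_le hβmin
  have he0 : (0 : ℝ) < klE0 := by norm_num [klE0]
  -- the rate `Λ_tel`
  obtain ⟨hΛ0, hΛle, hΛρ⟩ := rate_tel_laws hρ (nScales β)
  set Λ : ℝ := min (klScale klE0 (nScales β + 1)) (ρ * ((4 : ℝ) ^ (nScales β + 1))⁻¹) with hΛdef
  -- the instance data of the four atoms
  obtain ⟨L₂c, M₂c, hcovI⟩ := hcov1 μ hμ U hU0 hUU₁ β hβmin hβmax K Lstar Mstar hT Λ hΛ0.le hΛle hΛρ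
  obtain ⟨S₀, hS₀0, hS₀law, L₂e, M₂e, he1I⟩ := he11 μ hμ U hU0 hUU₂ β hβmin hβmax
  obtain ⟨sE, cR, cC, δ, hmisS, hmis0, L₂m, M₂m, hmisI⟩ := hmis1 μ hμ U hU0 hUU₃ β hβmin hβmax K Lstar Mstar hT
  obtain ⟨M₂h, hb1I⟩ := hb11 μ hμ U hU0 hUU₄ β hβmin hβmax K Lstar Mstar hT
  -- the Matsubara threshold of the package
  set Mth : ℕ → ℕ → ℕ := fun L b => max 1 (max (M₂c L b) (max (M₂e L) (max (M₂e (b * L)) (max (M₂m L b) (max (M₂h L b) (max (M₁ L) (M₁ (b * L)))))))) with hMth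
  have hMth1 : ∀ L b M, Mth L b ≤ M → 1 ≤ M := fun L b M h => by rw [hMth] at h; dsimp only at h; omega
  have hMthc : ∀ L b M, Mth L b ≤ M → M₂c L b ≤ M := fun L b M h => by rw [hMth] at h; dsimp only at h; omega
  have hMthe : ∀ L b M, Mth L b ≤ M → M₂e L ≤ M := fun L b M h => by rw [hMth] at h; dsimp only at h; omega
  have hMthe' : ∀ L b M, Mth L b ≤ M → M₂e (b * L) ≤ M := fun L b M h => by rw [hMth] at h; dsimp only at h; omega
  have hMthm : ∀ L b M, Mth L b ≤ M → M₂m L b ≤ M := fun L b M h => by rw [hMth] at h; dsimp only at h; omega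
  have hMthh : ∀ L b M, Mth L b ≤ M → M₂h L b ≤ M := fun L b M h => by rw [hMth] at h; dsimp only at h; omega
  have hMth₁ : ∀ L b M, Mth L b ≤ M → M₁ L ≤ M := fun L b M h => by rw [hMth] at h; dsimp only at h; omega
  have hMth₁' : ∀ L b M, Mth L b ≤ M → M₁ (b * L) ≤ M := fun L b M h => by rw [hMth] at h; dsimp only at h; omega
  -- constants' laws
  have hκ2 : ∀ j : ℕ, Real.sqrt (k₁ ^ 2 * ((8 : ℝ) ^ j)⁻¹) ^ 2 = k₁ ^ 2 * ((8 : ℝ) ^ j)⁻¹ := fun j => Real.sq_sqrt (by positivity)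
  have hκpos : ∀ j : ℕ, 0 < Real.sqrt (k₁ ^ 2 * ((8 : ℝ) ^ j)⁻¹) := fun j => Real.sqrt_pos.2 (by positivity)
  have hS₀law' : ∀ j, j ≤ nScales β → ∀ m, 1 ≤ m → S₀ j (2 * m) ≤ C₀ * klWtBudget P Qp U (j + 1) (2 * m) := fun j hj m hm =>
    (hS₀law j hj m hm).trans (mul_le_mul_of_nonneg_left (klWtBudget_mono_CE P hQCE (by rw [hQpCE]; linarith) hKl U (j + 1) (2 * m)) hC₀)
  -- the eventual threshold in `L` and the eventual data block
  set L₀ : ℕ := max L₂c (max L₂e (max L₂m L₁)) with hL₀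
  have hinst : ∀ᶠ L in atTop, ∀ (b M : ℕ) [NeZero L] [NeZero (b * L)] [NeZero M], Mth L b ≤ M →
      (∀ k, k ≤ nScales β → hubbardEffPartitionFnCT L M β U μ 0 (klFlowFrameU L M β U μ (nScales β + 1)) (klScale klE0 (k + 1)) ≠ 0) ∧
      (∀ k, k ≤ nScales β → hubbardEffPartitionFnCT (b * L) M β U μ 0 (klFlowFrameU (b * L) M β U μ (nScales β + 1)) (klScale klE0 (k + 1)) ≠ 0) ∧
      (∀ j, j < nScales β → ScaleCovData (klStepCov L M β μ (klFlowFrameU L M β U μ (nScales β + 1)) j) ((fun _ : ℕ => Λ) j)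
        ((fun j : ℕ => Real.sqrt (k₁ ^ 2 * ((8 : ℝ) ^ j)⁻¹)) j) ((fun j : ℕ => a₁ * (4 : ℝ) ^ j) j / imagTimeWeight β M) ((fun _ : ℕ => s₁) j)) ∧
      (∀ j, j < nScales β →
        ScaleCovData (klStepCov (b * L) M β μ (klFlowFrameU (b * L) M β U μ (nScales β + 1)) j) ((fun _ : ℕ => Λ) j)
          ((fun j : ℕ => Real.sqrt (k₁ ^ 2 * ((8 : ℝ) ^ j)⁻¹)) j) ((fun j : ℕ => a₁ * (4 : ℝ) ^ j) j / imagTimeWeight β M) ((fun _ : ℕ => s₁) j)) ∧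
      (∀ j, j ≤ nScales β → ∀ (m : ℕ) (q : Fin m) (w : SpaceTimeIdx L M × SectorLeg (sectorCount j)),
        klWtPinnedSumAt L M β μ (klFlowFrameU L M β U μ (nScales β + 1)) j ((fun j : ℕ => j) j) m
          (klEffectiveAction L M β U μ (klFlowFrameU L M β U μ (nScales β + 1)) klE0 (j + 1)) q w ≤ S₀ j m) ∧
      (∀ j, j ≤ nScales β → ∀ (m : ℕ) (q : Fin m) (w : SpaceTimeIdx (b * L) M × SectorLeg (sectorCount j)),
        klWtPinnedSumAt (b * L) M β μ (klFlowFrameU (b * L) M β U μ (nScales β + 1)) j ((fun j : ℕ => j) j) m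
          (klEffectiveAction (b * L) M β U μ (klFlowFrameU (b * L) M β U μ (nScales β + 1)) klE0 (j + 1)) q w ≤ S₀ j m) ∧
      (∀ j, j ≤ nScales β → SourceProfilesAtLevF L M (klSrcBudget P Q' U A (j + 1)) β U μ (klFlowFrameU L M β U μ (nScales β + 1))
        (srcWindowFamily L M) j ((fun j : ℕ => j) j) (j + 1)) ∧
      (∀ j, j ≤ nScales β →
        SourceProfilesAtLevF (b * L) M (klSrcBudget P Q' U A (j + 1)) β U μ (klFlowFrameU (b * L) M β U μ (nScales β + 1))
          (srcWindowFamily (b * L) M) j ((fun j : ℕ => j) j) (j + 1)) ∧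
      TowerCrossData L b M β μ (klFlowFrameU L M β U μ (nScales β + 1)) (klFlowFrameU (b * L) M β U μ (nScales β + 1)) (nScales β) (imagTimeWeight β M)
        (fun _ => Λ) (fun j => Real.sqrt (k₁ ^ 2 * ((8 : ℝ) ^ j)⁻¹)) (fun j => a₁ * (4 : ℝ) ^ j) (fun _ => s₁) (fun _ => e₁) (fun _ => Λ) (fun _ => w₁)
        (fun j => 3 * Real.sqrt (k₁ ^ 2 * ((8 : ℝ) ^ j)⁻¹)) (fun j => sE j L) (fun j => cR j L) (fun j => cC j L) (fun j => δ j L) := by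
    refine Filter.eventually_atTop.2 ⟨L₀, fun L hL b M _ _ _ hM => ?_⟩
    have hLc : L₂c ≤ L := by omega
    have hLe : L₂e ≤ L := by omega
    have hLm : L₂m ≤ L := by omega
    have hL₁ : L₁ ≤ L := by omega
    have hb1 : 1 ≤ b := Nat.pos_of_ne_zero fun hb => NeZero.ne (b * L) (by rw [hb, Nat.zero_mul])
    have hLbL : L ≤ b * L := Nat.le_mul_of_pos_left L hb1
    obtain ⟨hc1, hc2, hc3, hsec, htr⟩ := hcovI L b M hLc (hMthc L b M hM)
    obtain ⟨hZ, hread⟩ := he1I L M hLe (hMthe L b M hM)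
    obtain ⟨hZ', hread'⟩ := he1I (b * L) M (hLe.trans hLbL) (hMthe' L b M hM)
    obtain ⟨hent, hrow, hcol, htrow, htcol⟩ := hmisI L b M hLm (hMthm L b M hM)
    exact ⟨hZ, hZ', hc1, hc2, hread, hread', fun j hj => htok L M hL₁ (hMth₁ L b M hM) j (by omega),
      fun j hj => htok (b * L) M (hL₁.trans hLbL) (hMth₁' L b M hM) j (by omega),
      ⟨hc3, hsec, htr, fun j hj => gramPath_of_scaleCovData_same (hc3 j hj) (hc2 j hj), hent, hrow, hcol, htrow, htcol⟩⟩
  -- the base (H6) from `HB1`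
  have h0T : ∀ (k : ℕ) (η : ℝ), 0 < η → ∀ᶠ L in atTop, ∀ (b M : ℕ) [NeZero L] [NeZero (b * L)] [NeZero M], Mth L b ≤ M →
      ∀ (p : Fin k) (w : SrcLabel (b * L) M 0),
        (∀ i, 2 * (L / (4 * nScales β + 7)) ≤ (w.1.1.2 i).val % L ∧ (w.1.1.2 i).val % L + 2 * (L / (4 * nScales β + 7)) < L) →
        klKeyedDefectTSW L b M β U μ (klFlowFrameU L M β U μ (nScales β + 1)) (klFlowFrameU (b * L) M β U μ (nScales β + 1)) 1 0 k p w ≤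
          imagTimeWeight β M * η := by
    intro k η hη
    obtain ⟨L₂, hL₂⟩ := hb1I k η hη
    exact Filter.eventually_atTop.2 ⟨L₂, fun L hL b M _ _ _ hM p w hw => hL₂ L b M hL (hMthh L b M hM) p w hw⟩
  exact exists_towerDataTSW_of_readoutsH0W β U μ hβ Cw P Qp Q' hCEp hQ'CE hKl A hA Mth
    (fun _ => Λ) (fun _ => Λ) (fun j => Real.sqrt (k₁ ^ 2 * ((8 : ℝ) ^ j)⁻¹)) (fun j => 3 * Real.sqrt (k₁ ^ 2 * ((8 : ℝ) ^ j)⁻¹))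
    (fun j => a₁ * (4 : ℝ) ^ j) (fun _ => s₁) (fun _ => e₁) (fun _ => w₁) (fun _ => 1) (fun _ => 1) (fun _ => 1) sE cR cC δ (fun j => j)
    k₁ a₁ 1 1 3 w₁ 1 r₀ C₀ 1
    (fun _ => hΛ0) (fun _ => le_rfl) (fun _ => le_rfl) (fun j hj => hΛle.trans (klScale_le_klScale he0.le (by omega)))
    hk₁ hκpos hκ2 (fun j => by linarith [hκpos j]) (fun j => le_rfl) (by norm_num) (fun j => by positivity) (fun j => le_rfl)
    (fun _ => hs₁) (fun _ => he₁) (fun _ => hw₁) (fun _ => le_rfl) (fun _ => zero_le_one) (fun _ => le_rfl) (fun _ => zero_le_one) (fun _ => le_rfl)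
    (fun _ => zero_le_one) (fun _ => le_rfl) hr₀0 (by rw [hr₀]) hC₀
    S₀ hS₀0 hS₀law'
    (fun j hj => (heps j hj).1) (fun j hj => (heps j hj).2.1) (fun j hj => (heps j hj).2.2.1) (fun j hj => (heps j hj).2.2.2.1)
    (fun j hj => by have h := (heps j (le_of_lt hj)).2.2.2.2; linarith [h])
    (fun j L => hmisS j L) hmis0 hinst h0T

end Summit.HubbardSuperconductivity.HubbardSuperconductivity.Theorems.TwoVolumeSource

end
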